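import Literature.AlgebraicGeometry.Surfaces.K3RealMultiplicationCycleInduced
import Literature.AlgebraicGeometry.Surfaces.K3Marking
import HarnessLib

/-!
# The maximal ζ₉ real-multiplication family of K3 surfaces: the cycle on an open period set
# (van Geemen–Schütt 2025, Thm. 1.1 (9) / §4.8 / §5.6; CM anchor: Artebani–Comparin–Valdés 2020, family D2)

Family `hodge`, layer `Literature/AlgebraicGeometry/Surfaces`. Companion of
`K3RealMultiplicationCycleInduced` (EXISTENCE of one very general member of each van Geemen–Schütt
family, `VanGeemenSchuett2025_rmK3_cycleInduced_zeta9`) and of `K3RealMultiplicationZeta11OpenFamily`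
(the ζ₁₁ family as an open-period-set input). Here the ζ₉ family of Thm. 1.1 (9) — Picard number `10`,
real multiplication by the CUBIC field `F = ℚ(ζ₉ + ζ₉⁻¹)` — is typed as what it delivers to a consumer
that descends along rational Hodge isometries: a rational model endomorphism `θ ∈ M₂₂(ℚ)` of the K3
lattice, read off the order-`9` automorphism of the CM member of the family, together with an OPEN
subset of the Hodge locus of `θ` at the eigenvalue `2cos(2π/9)` at every period point of which a marked
member of the family carries an algebraic cycle inducing `θ` (the «∃-form open-set input» of the route
`HodgeConjecture/MarkmanPartnerTransport`, crux `PicardThreeK3Squares`, theorem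
`RMTypeOrbit.hodgeConjectureFor_square_of_exists_on_open_at_of_isK3Surface`).

## Sources (held texts `paper:arxiv-2310.05196` = [GeemenSchutt2023], Forum Math. Sigma 13 (2025) e2,
## and `paper:arxiv-1904.02045` = [ArtebaniComparinValdes2020Order9], Comm. Algebra 48 (2020); read 2026-08-28)

* [GeemenSchutt2023] Thm. 1.1: "(9) The 2-dimensional family of elliptic K3 surfaces in §5.6 has
  `ρ = 10` and RM by the cubic field `ℚ(ζ₉ + ζ₉⁻¹)`." §5.5: "A complete classification of the K3
  surfaces `X` with a non-symplectic automorphism `σ` of order `9` w.r.t. the fixed locus of `σ` is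
  given in [ArtebaniCV]. We use deformations of a 1-dimensional family to find an explicit
  2-dimensional family with RM by the degree three totally real field `ℚ(ζ₉ + ζ₉⁻¹)`." §5.6 (proof of
  Thm. 1.1 (9)): "A one-dimensional family (denoted by D2 in [ArtebaniCV]) of elliptic K3 surfaces
  with very general `ρ = 10` (hence `d = dim_ℚ(T_{X,ℚ}) = 12`) admitting a purely non-symplectic
  automorphism of order 9 is given by `y² = x³ + bx + c₁t⁹ + c₀`, `b, c₁, c₀ ∈ ℂ`. For very general
  `X` one has `Pic(X) = U ⊕ A₂⁴` … We deform (eq:9') by replacing `t⁹` by `p_{9,a}` (`a ∈ ℂ`). To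
  show that the Picard lattice is preserved by the deformation, note that the fibre at `∞` is clearly
  preserved. As for the Mordell–Weil lattice … Hence we get the same very general `Pic` as before. To
  show that one obtains a 2-dimensional family of elliptic K3 surfaces with RM by
  `F = ℚ(ζ₉ + ζ₉⁻¹)`, one modifies the proof of Proposition 4.6 by splitting `H²(𝓔̃_a, ℚ)` into three
  summands that are `D_n`-representations on which `σ` acts with eigenvalues `1`, primitive cube
  roots of unity and primitive nineth-roots of unity respectively. One shows that `T_a` lies in the
  last summand using that the intermediate `D₃`-cover is rational. The family is maximal, since the
  Picard lattice is preserved by the deformation."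
  §4.5–4.7 (Prop. 4.6 and its proof): the Weierstrass fibration `𝓔 : Y² = X³ + α(xⁿ)X + β(xⁿ)` with
  its "purely non-symplectic automorphism `σ₀` of order `n` given by `σ₀(X,Y,x) = (X,Y,ζ_n x)`"; the
  Dickson deformation `𝓔_a : Y² = X³ + α(p_{n,a}(x))X + β(p_{n,a}(x))` (`p_{9,a} = x⁹ - 9ax⁷ + 27a²x⁵
  - 30a³x³ + 9a⁴x`, `p_{n,0} = xⁿ`, §4.2; Lemma 4.3: `x ↦ p_{n,a}(x)` has monodromy `D_n` for `a ≠ 0`);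
  the pull-back `𝓔̃_a` along `x = v + a/v` with the `D_n`-action `σ(X,Y,v) = (X,Y,ζ_n v)`,
  `τ(X,Y,v) = (X,Y,a/v)`, "`𝓔̃_a → 𝓔_a` is birational to the quotient by `τ`", the Hodge substructure
  `T_a ⊂ H²(𝓔̃_a, ℚ)` with `T_a ≅ T_{𝓔_a,ℚ}`, and `σ^* + (σ⁻¹)^* ∈ End_Hod(T_a)`.
  **§4.8 "Cycles inducing the real multiplication"**: "`[Γ_k]_2 = (σ^{-k})^*` … the action of
  `ζ_n + ζ_n⁻¹` on `H²(𝓔̃_a, ℚ)` is induced by the cycle `Γ₁ + Γ₋₁` on `𝓔̃_a × 𝓔̃_a`. This cycle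
  induces one on `𝓔_a × 𝓔_a` which defines the real multiplication on `T_{X,ℚ}`." §2.6/§3.3–3.4: the
  K3 surfaces with a given action of the totally real field `F` on `T_{X,ℚ}`, `l = dim_F T_{X,ℚ}`, are
  parametrized by the period lines in one eigenspace `T_ε ⊗ ℂ`, an `(l - 2)`-dimensional space; here
  `l = 12/3 = 4`, `l - 2 = 2`.
* [ArtebaniComparinValdes2020Order9] Thm. 1 (i): an order-`9` non-symplectic automorphism `σ` of a K3
  surface is purely non-symplectic; §1 (after [Nikulin]): "the rank of the transcendental lattice of
  a K3 surface carrying a purely non-symplectic automorphism of order `n` is divisible by the Euler's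
  function of `n`" (the eigenvalues of `σ^*` on `(L^τ)^⊥ ⊗ ℂ` are the primitive `9`-th roots of
  unity, `τ = σ³`, `2m = 22 - rk(L^τ)`); Prop. 2.2 and Example 3.5 (Case D2): "`y² = x³ + x + t⁹ + c`
  … with the automorphism `σ(x,y,t) = (x,y,ζt)`. The fibration has a singular fiber of type `I₀*`
  over `t = ∞` … the invariants for `τ` are `(n,k,g) = (4,2,1)`. The automorphism `σ` on the fiber
  over `t = 0` acts as the identity, thus this corresponds to case D2"; so `m = 6`, `rk L^τ = 10`.

## Lean rendering (D-0014 named fact; PURE EXISTENCE, as printed)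

The tree has no Weierstrass models, so neither the members `𝓔_a` nor `σ₀` can be named; what CAN be
carried is the statement on the period side, for the model lattice `Λ = (K3Index → ℤ, k3Gram)`.
UNLIKE the ζ₁₁ companion (where Oguiso–Zhang, Thm. 1.5, locate EVERY order-`11` lattice datum with
invariant plane `U` inside the family, justifying a `∀`-form), no printed theorem locates every
order-`9` lattice datum of Picard rank `10` inside the D2 family ([ArtebaniComparinValdes2020Order9]
Prop. 4.1 gives equations only for the 2-dimensional components A1, A2, B; the five 1-dimensional
types C, D1–D4 with very general `rk T = 12` are classified by FIXED LOCUS, and by Lemma 1.4 there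
the eigenspace dimensions of `σ^*` do not separate D2 from D4 or C). The fact is therefore stated
in `∃`-form, exactly as delivered by the sources:

THE DATUM. Take a very general member `X₀ : y² = x³ + bx + c₁t⁹ + c₀` of the D2 family (§5.6;
[ArtebaniComparinValdes2020Order9] Ex. 3.5): a projective (elliptic) K3 surface with `ρ(X₀) = 10`,
`rk T(X₀) = 12`, carrying the purely non-symplectic automorphism `σ₀ : t ↦ ζ₉t` of order `9`; replace
`σ₀` by the power with `σ₀^*ω = e^{2πi/9}ω`. Let `(η₀, p₀, x₀)` be a marking of `X₀` (tree fact
`Huybrechts_K3_marking_exists`: `η₀` identifies `H²(X₀,ℤ)` with `ℤ^{22}` and the cup product with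
`k3Form`, `x₀ = ` the period) and put `g := η₀ ∘ σ₀^* ∘ η₀⁻¹`, `y₀ := x₀`. Then `g` is an integral
`k3Form`-isometry of `Λ_ℂ` with `g⁹ = 1` and `g y₀ = e^{2πi/9} y₀`, `(y₀.y₀) = 0 < (ȳ₀.y₀)`; the
eigenvalues of `σ₀^*` on `T(X₀)` are the primitive `9`-th roots of unity ([Nikulin 1979, Thm. 3.1];
[ArtebaniComparinValdes2020Order9] §1) and `τ₀ = σ₀³` fixes `NS(X₀) = L^{τ₀}` (`rk L^{τ₀} = 22 - 2m =
10 = ρ(X₀)`, `L^{τ₀} ⊆ NS` primitive), so `ker(g³ - 1) = η₀(NS(X₀) ⊗ ℂ)` has dimension `10` and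
`T := ker Φ₉(g) = η₀(T(X₀) ⊗ ℂ)`, `Λ_ℂ = T ⊕ ker(g³ - 1)`. THE MODEL ENDOMORPHISM is
`θ_ℂ := (g + g⁻¹) ∘ P_T` with `P_T = -⅓(g³ - 1)(g³ + 2)` the projector onto `T` along `ker(g³ - 1)`
(`Φ₉(x) - (x³ - 1)(x³ + 2) = 3`), i.e. — reducing modulo `g⁹ = 1` —
`θ_ℂ = ⅓(2g + 2g⁸ - g² - g⁴ - g⁵ - g⁷)`: rational (entries in `⅓ℤ`), `k3Form`-self-adjoint (the
adjoint of `gᵏ` is `g^{9-k}`), `= 0` on `η₀(NS)`, `= g + g⁻¹` on `T`, with `θ_ℂ y₀ = e₀ y₀`,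
`e₀ = ζ₉ + ζ₉⁻¹ = 2cos(2π/9)` (a root of `X³ - 3X + 1`, the polynomial of
`VanGeemenSchuett2025_rmK3_cycleInduced_zeta9`).
THE OPEN SET. Along the Dickson deformation `𝓔_{a,b,c₁,c₀} : y² = x³ + bx + c₁p_{9,a}(t) + c₀`
(a smooth family of K3 surfaces near `a = 0`, `𝓔_{0,…} = X₀`; markings `η` transported from `η₀`;
`NS = U ⊕ A₂⁴` constant, §5.6) the class `[Z_a]`, `Z_a = ½(q × q)_*(Γ_σ + Γ_{σ⁻¹}) ∘ π_T`
(`q : 𝓔̃_a ⇢ 𝓔_a` the quotient by `τ`, §4.7; `π_T = Δ - Σᵢ Dᵢ × Dᵢ^∨` over a basis of `NS`, Fulton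
Prop. 16.1.1; `a ≠ 0`), is algebraic, flat (an algebraic family of cycles), cup-self-adjoint, kills
`NS` and acts on `T_{𝓔_a,ℚ}` as the real multiplication `t` by `ζ₉^{j} + ζ₉^{-j}` of §4.8 (`q^* ∘ t =
(σ^* + (σ⁻¹)^*) ∘ q^*`, `q_* q^* = 2`); its flat limit at `a = 0` is a Hodge class acting on `T(X₀)_ℚ`
inside the FIELD `End_Hdg T(X₀)_ℚ ∋ σ₀^*|_T` (Zarhin) with `(2,0)`-eigenvalue `ζ₉^{j} + ζ₉^{-j}`,
hence equal there to `σ₀^{*j} + σ₀^{*-j}`; replacing `Z_a` by `Q(Z_a) ∘ π_T` for the polynomial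
`Q ∈ ℚ[X]` with `Q(ζ₉ʲ + ζ₉⁻ʲ) = ζ₉ + ζ₉⁻¹` (same cubic field; powers of an algebraic
self-correspondence are algebraic, Fulton Prop. 16.1.1) one gets on EVERY member an algebraic class
`γ'` with `[γ']_* = η⁻¹ ∘ θ_ℂ ∘ η`. "The family is maximal" (Thm. 1.1 (9): `2 = l - 2` moduli) = the
marked period image `Ω` of the family is open in the `2`-dimensional Hodge locus
`D_{θ,e₀} = {y : θ_ℂ y = e₀ y, (y.y) = 0, (ȳ.y) > 0}` (this reading of «2-dimensional family» — `2`
EFFECTIVE moduli — is the paper's, §2.6/§3.4; it is the same reading as in the ζ₁₁ companion); the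
open set of the statement is any open `U ⊂ Λ_ℂ` with `U ∩ D_{θ,e₀} ⊆ ℂ^× · Ω`, `U ∩ D_{θ,e₀} ≠ ∅`, and
at each of its period points the marked member with that period line carries the cycle. The cycle
clause is quantified only over `θ`-GENERIC period points (every rational vector orthogonal to `y` is
killed by `θ`, i.e. `NS = η⁻¹ ker θ` has rank `10`) — weaker than what the argument gives — because
that is the consumer's binder (`CycleEx[θ, e₀, U]` of `…RMTypeOpenSingleEigenvalue`, VERBATIM with
`thetaC θ` unfolded to `Matrix.toLin' (θ.map (algebraMap ℚ ℂ))`, and the route's `MarkedK3` binder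
expanded verbatim).

NOT CLAIMED: that EVERY integral order-`9` isometry of `Λ` with a rank-`10` cube-fixed part and a
period point in its `e^{2πi/9}`-eigenspace arises this way (types C, D1, D3, D4 and no printed
equation-uniqueness for D2 — see above). REMARK (not formalised, not used): by Landherr's Hasse
principle for hermitian forms over `ℚ(ζ₉)/ℚ(ζ₉)⁺` all such data have RATIONALLY conjugate model
endomorphisms `θ` (the hermitian plane on `T_ℚ` is unimodular away from `3` and has signatures
`(1,1), (0,2), (0,2)`), so the `∃θ` below ranges over a single `O(Λ_ℚ)`-conjugacy class.
TODO(general form): once elliptic K3 surfaces with Weierstrass models are in the tree, state §5.6 +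
§4.8 for every member `𝓔_a` and derive this fact from it.

## References

* [GeemenSchutt2023] B. van Geemen, M. Schütt, On families of K3 surfaces with real multiplication,
  Forum Math. Sigma 13 (2025) e2, arXiv:2310.05196: Thm. 1.1 (9), §2.4–2.6, §3.3–3.4, §4.2,
  Lemma 4.3, §4.5, Prop. 4.6–4.7, §4.8, Rem. 4.9, §5.5–5.6.
* [ArtebaniComparinValdes2020Order9] M. Artebani, P. Comparin, M. E. Valdés, Order 9 automorphisms of
  K3 surfaces, Comm. Algebra 48 (2020) 3661–3672 (arXiv:1904.02045): Thm. 1, Lemma 1.4, Prop. 2.2,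
  Example 3.5 (Case D2).
* [Nikulin1979FiniteAutK3] V. V. Nikulin, Finite groups of automorphisms of Kählerian K3 surfaces,
  Trudy Moskov. Mat. Obshch. 38 (1979): Thm. 3.1.
* [Huybrechts2016K3] D. Huybrechts, Lectures on K3 Surfaces, CUP 2016: Ch. 1 Prop. 3.5, Ch. 3
  Cor. 3.6 (Zarhin: `End_Hdg T(X)_ℚ` is a field), Ch. 6 Prop. 1.2.
* [Fulton1998] W. Fulton, Intersection Theory, 2nd ed., §16.1 Prop. 16.1.1.
-/

noncomputable section

open CategoryTheory MonoidalCategory Polynomial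
open Literature.AlgebraicTopology.SingularHomology
open Literature.AlgebraicGeometry.HodgeTheory

namespace Literature.AlgebraicGeometry.Surfaces

/-- **van Geemen–Schütt, Thm. 1.1 (9) with §4.8 and §5.6 (the maximal `ζ₉` real-multiplication
family, Picard number `10`), anchored at its CM member (Artebani–Comparin–Valdés, Ex. 3.5, type D2):
the model endomorphism `ζ₉ + ζ₉⁻¹` is induced by an algebraic cycle at every period point of an open
subset of its Hodge locus.** THERE EXIST an integral isometry `g` of the K3 lattice
`Λ = (ℤ^{22}, k3Gram)` (a `ℂ`-linear `k3Form`-isometry of `Λ_ℂ` mapping `ℤ^{22}` into itself) with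
`g⁹ = 1` whose cube-fixed part `ker(g³ - 1)` has dimension `10` — the cohomological action, in a
marking `η₀`, of the order-`9` automorphism `σ₀ : t ↦ ζ₉t` (normalised by `σ₀^*ω = e^{2πi/9}ω`) of a very
general member `X₀ : y² = x³ + bx + c₁t⁹ + c₀` of the D2 family, `ρ(X₀) = 10`,
`ker(g³ - 1) = η₀ NS(X₀)_ℂ` —, a period point `y₀` (`(y₀.y₀) = 0`, `(ȳ₀.y₀) > 0`) with
`g y₀ = e^{2πi/9} y₀` (the period of `X₀`), and a rational matrix `θ` with
`θ_ℂ = ⅓(2g + 2g⁸ - g² - g⁴ - g⁵ - g⁷) = (g + g⁻¹) ∘ P_T` (`P_T = -⅓(g³ - 1)(g³ + 2)` the projector onto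
`T = ker Φ₉(g) = η₀ T(X₀)_ℂ` along `η₀ NS(X₀)_ℂ`; the model of the real multiplication `ζ₉ + ζ₉⁻¹`,
`= 0` on `NS`), AND an open `U ⊂ Λ_ℂ` meeting the Hodge locus
`D_{θ,e₀} = {y : θ_ℂ y = e₀ y, (y.y) = 0, (ȳ.y) > 0}`, `e₀ = 2cos(2π/9) = ζ₉ + ζ₉⁻¹`, such that every
`θ`-generic period point `y ∈ U ∩ D_{θ,e₀}` (every rational vector orthogonal to `y` is killed by `θ`)
is the period of a marked projective K3 surface `(S', η', p')` (the route's `MarkedK3` clauses)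
carrying an algebraic class `γ' ∈ algebraicClasses (S' ⊗ S') 2` whose correspondence
`[γ']_* = fst_* (snd^*(–) ∪ γ')` (complex orientations) is EXACTLY `η'⁻¹ ∘ θ_ℂ ∘ η'` — the member of
the Dickson deformation `y² = x³ + bx + c₁p_{9,a}(t) + c₀` with that period (Thm. 1.1 (9): `2 = l - 2`
moduli, a maximal family, so the marked period image is open in the `2`-dimensional Hodge locus) and
its cycle `Q(½(q × q)_*(Γ_σ + Γ_{σ⁻¹})) ∘ π_{NS^⊥}` (§4.8: "the action of `ζ_n + ζ_n⁻¹` … is induced by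
the cycle `Γ₁ + Γ₋₁` … This cycle induces one on `𝓔_a × 𝓔_a` which defines the real multiplication
on `T_{X,ℚ}`"; flat in the transported marking and equal to `θ` there, see the module docstring).
VERBATIM the input `∃ U, IsOpen U ∧ (∃ y₁ ∈ U ∩ D_{θ,e₀}) ∧ CycleEx[θ, e₀, U]` of the consumer (T‴)
`…Theorems.MarkmanPartnerTransport.RMTypeOrbit.…_square_of_exists_on_open_at_of_isK3Surface` of the
Hodge summit. Pure existence; no uniqueness of the datum is asserted.
[cite: GeemenSchutt2023, Thm. 1.1 (9), §4.5, Prop. 4.6, §4.8, §5.6, §2.6]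
[cite: ArtebaniComparinValdes2020Order9, Thm. 1 (i), Prop. 2.2, Example 3.5]
[cite: Huybrechts2016K3, Ch. 1 Prop. 3.5, Ch. 3 Cor. 3.6, Ch. 6 Prop. 1.2]
[cite: Fulton1998, §16.1 Prop. 16.1.1] -/
def VanGeemenSchuett2025_zeta9_cycleOnOpenPeriodSet : Prop :=
  ∃ (g : Module.End ℂ (K3Index → ℂ)) (y₀ : K3Index → ℂ) (θ : Matrix K3Index K3Index ℚ),
    -- `g` is an integral isometry of `Λ` of order dividing `9`
    (∀ a b : K3Index → ℂ, k3Form (g a) (g b) = k3Form a b) ∧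
    (∀ v : K3Index → ℤ, ∃ w : K3Index → ℤ, g (fun i => (v i : ℂ)) = fun i => (w i : ℂ)) ∧
    g ^ 9 = 1 ∧
    -- the cube-fixed part `ker(g³ - 1)` (`= η₀ NS(X₀)_ℂ`) has dimension `10`: Picard number `10`
    Module.finrank ℂ (LinearMap.ker (g ^ 3 - 1)) = 10 ∧
    -- the `e^{2πi/9}`-eigenspace of `g` carries a period point
    k3Form y₀ y₀ = 0 ∧ 0 < (k3Form (star y₀) y₀).re ∧
    g y₀ = Complex.exp (2 * Real.pi * Complex.I / 9) • y₀ ∧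
    -- `θ_ℂ = (g + g⁻¹) ∘ P_T = ⅓(2g + 2g⁸ - g² - g⁴ - g⁵ - g⁷)`
    (∀ y : K3Index → ℂ, Matrix.toLin' (θ.map (algebraMap ℚ ℂ)) y =
      (1 / 3 : ℂ) • ((2 : ℂ) • g y + (2 : ℂ) • (g ^ 8) y - (g ^ 2) y - (g ^ 4) y - (g ^ 5) y
        - (g ^ 7) y)) ∧
    ∃ U : Set (K3Index → ℂ), IsOpen U ∧
      (∃ y₁ ∈ U, Matrix.toLin' (θ.map (algebraMap ℚ ℂ)) y₁ =
          ((2 * Real.cos (2 * Real.pi / 9) : ℝ) : ℂ) • y₁ ∧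
        k3Form y₁ y₁ = 0 ∧ 0 < (k3Form (star y₁) y₁).re) ∧
      ∀ y : K3Index → ℂ, y ∈ U →
        Matrix.toLin' (θ.map (algebraMap ℚ ℂ)) y = ((2 * Real.cos (2 * Real.pi / 9) : ℝ) : ℂ) • y →
        k3Form y y = 0 → 0 < (k3Form (star y) y).re →
        (∀ v : K3Index → ℚ, k3Form (fun i => (v i : ℂ)) y = 0 → Matrix.mulVec θ v = 0) →
        ∃ (S' : Motives.SchemeOver ℂ) (hS' : IsK3Surface S')
          (η' : complexBetti S' (2 * 1) ≃ₗ[ℂ] (K3Index → ℂ)) (p' : complexBetti S' (2 * 2)),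
          (p' ≠ 0 ∧ (IsIntegralClass p' ∧
            (∀ q : complexBetti S' (2 * 2), IsIntegralClass q → ∃ n : ℤ, q = n • p') ∧
            (∀ c : complexBetti S' (2 * 1),
              IsIntegralClass c ↔ ∃ v : K3Index → ℤ, η' c = fun i => (v i : ℂ)) ∧
            (∀ a b : complexBetti S' (2 * 1),
              cupProduct (rfl : 2 * 1 + 2 * 1 = 2 * 2) a b = k3Form (η' a) (η' b) • p') ∧
            IsOfHodgeType 2 S' (2 * 1) 2 0 (LinearEquiv.symm η' y) ∧
            (∀ τ : complexBetti S' (2 * 1), IsOfHodgeType 2 S' (2 * 1) 2 0 τ →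
              ∃ t : ℂ, τ = t • LinearEquiv.symm η' y)) ∧
            (k3Form y y = 0 ∧ 0 < (k3Form (star y) y).re ∧
              ∃ u : K3Index → ℤ, k3Form (fun i => (u i : ℂ)) y = 0 ∧
                0 < ∑ i, ∑ j, u i * k3Gram i j * u j)) ∧
          ∃ γ' ∈ algebraicClasses (S' ⊗ S') 2, ∀ z : complexBetti S' (2 * 1),
            (η'.symm.toLinearMap ∘ₗ (Matrix.toLin' (θ.map (algebraMap ℚ ℂ)) ∘ₗ η'.toLinearMap)) z =
              complexGysin complexOrientationFamily
                (Motives.IsSmoothProjective.tensor_holds hS'.isSmoothProjective hS'.isSmoothProjective)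
                hS'.isSmoothProjective (SemiCartesianMonoidalCategory.fst S' S')
                (rfl : 2 * 1 + 2 * 2 + 2 * 2 = 2 * 1 + 2 * (2 + 2))
                (cupProduct (rfl : 2 * 1 + 2 * 2 = 2 * 1 + 2 * 2)
                  (complexBetti.map (SemiCartesianMonoidalCategory.snd S' S') (2 * 1) z) γ')

/-! ### The ∀-member form (cycle on EVERY member over the open period set) -/

/-- **van Geemen–Schütt, Thm. 1.1 (9) with §4.8 and §5.6 (the maximal `ζ₉` real-multiplication family,
Picard number `10` very generally), anchored at its CM member (Artebani–Comparin–Valdés, Ex. 3.5, type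
D2): the model endomorphism `ζ₉ + ζ₉⁻¹` is induced by an algebraic cycle on EVERY member over an open
period set — the `θ`-generic members AND the Noether–Lefschetz-special ones.** Same datum and same
sources as `VanGeemenSchuett2025_zeta9_cycleOnOpenPeriodSet` (module docstring of
`K3RealMultiplicationZeta9OpenFamily`): an integral isometry `g` of the K3 lattice `Λ = (ℤ²², k3Gram)`
with `g⁹ = 1` and cube-fixed part `ker(g³ - 1)` of dimension `10` (the action of the order-`9`
automorphism `σ₀ : t ↦ ζ₉t` of a very general member `X₀ : y² = x³ + bx + c₁t⁹ + c₀` of the D2 family in a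
marking `η₀`, `ker(g³ - 1) = η₀ NS(X₀)_ℂ`), a period point `y₀` with `g y₀ = e^{2πi/9} y₀`, the rational
model endomorphism `θ_ℂ = ⅓(2g + 2g⁸ - g² - g⁴ - g⁵ - g⁷) = (g + g⁻¹) ∘ P_T` (`= 0` on `η₀ NS(X₀)`), AND an
open `U ⊂ Λ_ℂ` such that (i) `U` contains a `θ`-GENERIC period point of the Hodge locus
`D_{θ,e₀} = {y : θ_ℂ y = e₀ y, (y.y) = 0, (ȳ.y) > 0}`, `e₀ = 2cos(2π/9)` (the period of a very general
member of the Dickson deformation `y² = x³ + bx + c₁p_{9,a}(t) + c₀`: its Néron–Severi lattice is the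
transported `η₀ NS(X₀) = ker θ ∩ Λ`, §5.6 «the Picard lattice is preserved by the deformation»), and
(ii) EVERY period point `y ∈ U ∩ D_{θ,e₀}` — `θ`-generic or not — is the period of a marked projective K3
surface `(S', η', p')` (the route's `MarkedK3` clauses) carrying an algebraic class
`γ' ∈ algebraicClasses (S' ⊗ S') 2` whose correspondence `[γ']_* = fst_*(snd^*(–) ∪ γ')` (complex
orientations) is EXACTLY `η'⁻¹ ∘ θ_ℂ ∘ η'`: the member of the Dickson deformation with that period
(Thm. 1.1 (9): `2 = l - 2` effective moduli, a MAXIMAL family, so the marked period image contains an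
open subset of the `2`-dimensional Hodge locus and `U` is taken inside its cone) and its cycle
`Q(½(q × q)_*(Γ_σ + Γ_{σ⁻¹})) ∘ π_{NS^⊥}` (§4.8: "the action of `ζ_n + ζ_n⁻¹` … is induced by the cycle
`Γ₁ + Γ₋₁` … This cycle induces one on `𝓔_a × 𝓔_a` which defines the real multiplication on `T_{X,ℚ}`";
algebraic on every member `a ≠ 0`, flat in the transported marking, hence equal to `θ_ℂ` there for
EVERY member — including the members with larger Néron–Severi lattice, cf. §6.6 for the analogous
Noether–Lefschetz sub-loci of the `√2`-family). This is the quantification «which the argument gives»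
recorded in the docstring of `VanGeemenSchuett2025_zeta9_cycleOnOpenPeriodSet`, whose cycle clause was
restricted to `θ`-generic periods only to match its first consumer; the present ∀-member form is the
binder `OpenAll[θ, e₀]` of the sub-type descent (T⁗)
`…Theorems.MarkmanPartnerTransport.RMTypeOrbit.…_square_of_openAll_of_transc` of the Hodge summit
(Noether–Lefschetz-special surfaces of the locus), and it implies the older fact
(drop the genericity clause of the witness, restrict the cycle clause). Pure existence; no uniqueness of the datum is
asserted; NOT CLAIMED: that every order-`9` lattice datum of Picard rank `10` arises this way.
TODO(general form): once elliptic K3 surfaces with Weierstrass models are in the tree, state §5.6 + §4.8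
for every member `𝓔_a` and derive this fact from it.
[cite: GeemenSchutt2023, Thm. 1.1 (9), §2.6, §3.4, §4.5, Prop. 4.6, §4.8, §5.6 and §6.6]
[cite: ArtebaniComparinValdes2020Order9, Thm. 1 (i), Prop. 2.2, Example 3.5]
[cite: Huybrechts2016K3, Ch. 1 Prop. 3.5, Ch. 3 Cor. 3.6, Ch. 6 Prop. 1.2 and Rem. 3.3]
[cite: Fulton1998, §16.1 Prop. 16.1.1] -/
def VanGeemenSchuett2025_zeta9_cycleOnOpenPeriodSet_everyMember : Prop :=
  ∃ (g : Module.End ℂ (K3Index → ℂ)) (y₀ : K3Index → ℂ) (θ : Matrix K3Index K3Index ℚ),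
    -- `g` is an integral isometry of `Λ` of order dividing `9`
    (∀ a b : K3Index → ℂ, k3Form (g a) (g b) = k3Form a b) ∧
    (∀ v : K3Index → ℤ, ∃ w : K3Index → ℤ, g (fun i => (v i : ℂ)) = fun i => (w i : ℂ)) ∧
    g ^ 9 = 1 ∧
    -- the cube-fixed part `ker(g³ - 1)` (`= η₀ NS(X₀)_ℂ`) has dimension `10`: Picard number `10`
    Module.finrank ℂ (LinearMap.ker (g ^ 3 - 1)) = 10 ∧
    -- the `e^{2πi/9}`-eigenspace of `g` carries a period point
    k3Form y₀ y₀ = 0 ∧ 0 < (k3Form (star y₀) y₀).re ∧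
    g y₀ = Complex.exp (2 * Real.pi * Complex.I / 9) • y₀ ∧
    -- `θ_ℂ = (g + g⁻¹) ∘ P_T = ⅓(2g + 2g⁸ - g² - g⁴ - g⁵ - g⁷)`
    (∀ y : K3Index → ℂ, Matrix.toLin' (θ.map (algebraMap ℚ ℂ)) y =
      (1 / 3 : ℂ) • ((2 : ℂ) • g y + (2 : ℂ) • (g ^ 8) y - (g ^ 2) y - (g ^ 4) y - (g ^ 5) y
        - (g ^ 7) y)) ∧
    ∃ U : Set (K3Index → ℂ), IsOpen U ∧
      -- (i) a `θ`-GENERIC period point of `D_{θ,e₀}` in `U` (a very general member)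
      (∃ y₁ ∈ U, Matrix.toLin' (θ.map (algebraMap ℚ ℂ)) y₁ =
          ((2 * Real.cos (2 * Real.pi / 9) : ℝ) : ℂ) • y₁ ∧
        k3Form y₁ y₁ = 0 ∧ 0 < (k3Form (star y₁) y₁).re ∧
        ∀ v : K3Index → ℚ, k3Form (fun i => (v i : ℂ)) y₁ = 0 → Matrix.mulVec θ v = 0) ∧
      -- (ii) the cycle on EVERY member over `U`
      ∀ y : K3Index → ℂ, y ∈ U →
        Matrix.toLin' (θ.map (algebraMap ℚ ℂ)) y = ((2 * Real.cos (2 * Real.pi / 9) : ℝ) : ℂ) • y →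
        k3Form y y = 0 → 0 < (k3Form (star y) y).re →
        ∃ (S' : Motives.SchemeOver ℂ) (hS' : IsK3Surface S')
          (η' : complexBetti S' (2 * 1) ≃ₗ[ℂ] (K3Index → ℂ)) (p' : complexBetti S' (2 * 2)),
          (p' ≠ 0 ∧ (IsIntegralClass p' ∧
            (∀ q : complexBetti S' (2 * 2), IsIntegralClass q → ∃ n : ℤ, q = n • p') ∧
            (∀ c : complexBetti S' (2 * 1),
              IsIntegralClass c ↔ ∃ v : K3Index → ℤ, η' c = fun i => (v i : ℂ)) ∧
            (∀ a b : complexBetti S' (2 * 1),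
              cupProduct (rfl : 2 * 1 + 2 * 1 = 2 * 2) a b = k3Form (η' a) (η' b) • p') ∧
            IsOfHodgeType 2 S' (2 * 1) 2 0 (LinearEquiv.symm η' y) ∧
            (∀ τ : complexBetti S' (2 * 1), IsOfHodgeType 2 S' (2 * 1) 2 0 τ →
              ∃ t : ℂ, τ = t • LinearEquiv.symm η' y)) ∧
            (k3Form y y = 0 ∧ 0 < (k3Form (star y) y).re ∧
              ∃ u : K3Index → ℤ, k3Form (fun i => (u i : ℂ)) y = 0 ∧
                0 < ∑ i, ∑ j, u i * k3Gram i j * u j)) ∧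
          ∃ γ' ∈ algebraicClasses (S' ⊗ S') 2, ∀ z : complexBetti S' (2 * 1),
            (η'.symm.toLinearMap ∘ₗ (Matrix.toLin' (θ.map (algebraMap ℚ ℂ)) ∘ₗ η'.toLinearMap)) z =
              complexGysin complexOrientationFamily
                (Motives.IsSmoothProjective.tensor_holds hS'.isSmoothProjective hS'.isSmoothProjective)
                hS'.isSmoothProjective (SemiCartesianMonoidalCategory.fst S' S')
                (rfl : 2 * 1 + 2 * 2 + 2 * 2 = 2 * 1 + 2 * (2 + 2))
                (cupProduct (rfl : 2 * 1 + 2 * 2 = 2 * 1 + 2 * 2)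
                  (complexBetti.map (SemiCartesianMonoidalCategory.snd S' S') (2 * 1) z) γ')

end Literature.AlgebraicGeometry.Surfaces

end
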